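import Summits.Parity.GeneralizedHardyLittlewood.Theorems.PrimeLevelFamEdgeMomentsBeyondDiagonalIdentificationAtOne
import HarnessLib

/-!
# Route `PrimeLevelFamEdge`, crux K_A `MomentsBeyondDiagonal` (stmt-Parity-20007), line «petersson_layers» v4:
# THE CRUX AT `Q = 1`, DE-AUTOMORPHISED — the second display of `Q^h(P,1)` beyond the diagonal is EQUIVALENT to an asymptotic for the
# explicit finite sum `D − Σ_{r ≤ q⁸} K_r`, and K_A IMPLIES that explicit asymptotic (lead prover, 2026-08-28; helper)

With the identification at `Q = 1` (`tailNearFar_atOne`, p634139) and the algebraic split (`tail_add_farLayers`, deck 21c):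
* §1 `norm_QhPQ_one_sub_explicit_le`: for every `P` there is `C` with
  `‖Q^h(P,1)(q̂^{Δ'}) − (diagPart q P 1 Δ' − Σ_{r∈[1,q⁸]} layer q P 1 Δ' r)‖ ≤ C q̂ (log q̂)⁻³` for all `Δ' ∈ (1, 3/2]`, primes `q ≥ 64`;
* §2 `secondDisplayAtOne_iff_explicit`: «`Q^h(P,1)` has the second-display shape with SOME level-free functional on SOME window beyond the
  diagonal (∀ admissible `P`)» ⟺ «the explicit piece `D − Σ_{r≤q⁸} K_r` does» — the `Q = 1` crux is a statement about finite sums of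
  Kloosterman sums `S(a,b;qr)`, Bessel values `J₁`, Möbius coefficients and KMV's cut-off `W`, with NO cusp form in it;
* §3 `explicitAtOne_of_momentsBeyondDiagonal`: the registered crux `MomentsBeyondDiagonal` IMPLIES that explicit asymptotic (its `Q = 1`,
  second-display projection, functional `secondMomentForm Δ' P 1 + T₂ Δ' P 1`) — a NECESSARY condition for K_A in cusp-form-free terms, i.e. a
  legitimate explicit-sum TARGET for the crux's disprover (refute it ⇒ `¬ MomentsBeyondDiagonal`).
Nothing here proves or refutes K_A (open, famE-02); no exceptional-zero claim (no GRH, no Landau–Siegel).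
-/

noncomputable section

open scoped Real
open Complex Finset Polynomial
open Literature.NumberTheory.LFunctions

namespace Summit.Parity.GeneralizedHardyLittlewood.Theorems.PrimeLevelFamEdgeIdeaDeltas.PeterssonLayers

open Summit.Parity.GeneralizedHardyLittlewood.Theses.PrimeLevelFamEdge (MomentsBeyondDiagonal)

/-! ## §1. `Q^h(P,1)` minus the explicit piece is `O(q̂ log⁻³ q̂)` (indeed `O(1)`) -/

/-- **§1.** For every real polynomial `P` there is `C` such that for all `Δ' ∈ (1, 3/2]` and all primes `q ≥ 64`:
`‖Q^h(P,1)(q̂^{Δ'}) − (diagPart q P 1 Δ' − Σ_{r ∈ [1, q⁸]} layer q P 1 Δ' r)‖ ≤ C · q̂ · (log q̂)⁻³`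
(`tail ρ_P + far ρ_P = Q^h − D + Σ_{r≤q⁸} K_r` by `tail_add_farLayers`, and `tailNearFar_atOne` at the print cut `ρ_P ≤ 8`). -/
theorem norm_QhPQ_one_sub_explicit_le (P : ℝ[X]) :
    ∃ C : ℝ, ∀ Δ' : ℝ, 1 < Δ' → Δ' ≤ 3 / 2 → ∀ (q : ℕ) [NeZero q], q.Prime → 64 ≤ q →
      ‖KMV2000.QhPQ q P 1 (KMV2000.qhat q ^ Δ') -
          (diagPart q P 1 Δ' - ∑ r ∈ Icc 1 (q ^ 8), layer q P 1 Δ' r)‖ ≤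
        C * KMV2000.qhat q * (Real.log (KMV2000.qhat q))⁻¹ ^ 3 := by
  obtain ⟨C, hC⟩ := tailNearFar_atOne P rhoP (fun Δ' h₁ h₂ ↦ rhoP_le_eight Δ' h₁ h₂)
  refine ⟨C, fun Δ' h1 h32 q _ hq h64 ↦ ?_⟩
  have h := hC Δ' h1 h32 q hq h64
  have hE := tail_add_farLayers q rhoP P 1 Δ' (layerCount_le_pow_eight h64 (rhoP_le_eight Δ' h1 h32))
  rw [sub_neg_eq_add, hE] at h
  have e : KMV2000.QhPQ q P 1 (KMV2000.qhat q ^ Δ') -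
      (diagPart q P 1 Δ' - ∑ r ∈ Icc 1 (q ^ 8), layer q P 1 Δ' r) =
      KMV2000.QhPQ q P 1 (KMV2000.qhat q ^ Δ') - diagPart q P 1 Δ' + ∑ r ∈ Icc 1 (q ^ 8), layer q P 1 Δ' r := by ring
  rw [e]
  exact h

/-! ## §2. The second display at `Q = 1` ⟺ the explicit asymptotic -/

/-- **§2. THE `Q = 1` CRUX, DE-AUTOMORPHISED (kernel):**
(∃ window `(1,Δ]`, ∃ level-free `t`, ∀ admissible `P`, the mollified second moment `Q^h(P,1)(q̂^{Δ'})` equals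
`2ζ(2)² q̂/(Δ'² log² q̂) · t(Δ',P) + O(q̂ log⁻³ q̂)` along the primes with `q̂^{Δ'} ∉ ℕ`)
⟺ (the same for the EXPLICIT finite sum `diagPart q P 1 Δ' − Σ_{r ≤ q⁸} layer q P 1 Δ' r`).
Windows are intersected with `(1, 3/2]`; the functional `t` is the same on both sides. -/
theorem secondDisplayAtOne_iff_explicit :
    (∃ Δ : ℝ, 1 < Δ ∧ ∃ t : ℝ → ℝ[X] → ℝ, ∀ P : ℝ[X], KMV2000.Admissible P → ∀ Δ' : ℝ, 1 < Δ' → Δ' ≤ Δ →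
      ∃ C : ℝ, ∃ q₀ : ℕ, ∀ (q : ℕ) [NeZero q], q.Prime → q₀ ≤ q →
        (∀ n : ℕ, (n : ℝ) ≠ KMV2000.qhat q ^ Δ') →
          ‖KMV2000.QhPQ q P 1 (KMV2000.qhat q ^ Δ') -
              ((2 * riemannZeta 2 ^ 2 *
                  ((KMV2000.qhat q / (Δ' ^ 2 * Real.log (KMV2000.qhat q) ^ 2) : ℝ) : ℂ)) * ((t Δ' P : ℝ) : ℂ))‖ ≤
            C * KMV2000.qhat q * (Real.log (KMV2000.qhat q))⁻¹ ^ 3) ↔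
    (∃ Δ : ℝ, 1 < Δ ∧ ∃ t : ℝ → ℝ[X] → ℝ, ∀ P : ℝ[X], KMV2000.Admissible P → ∀ Δ' : ℝ, 1 < Δ' → Δ' ≤ Δ →
      ∃ C : ℝ, ∃ q₀ : ℕ, ∀ (q : ℕ) [NeZero q], q.Prime → q₀ ≤ q →
        (∀ n : ℕ, (n : ℝ) ≠ KMV2000.qhat q ^ Δ') →
          ‖(diagPart q P 1 Δ' - ∑ r ∈ Icc 1 (q ^ 8), layer q P 1 Δ' r) -
              ((2 * riemannZeta 2 ^ 2 *
                  ((KMV2000.qhat q / (Δ' ^ 2 * Real.log (KMV2000.qhat q) ^ 2) : ℝ) : ℂ)) * ((t Δ' P : ℝ) : ℂ))‖ ≤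
            C * KMV2000.qhat q * (Real.log (KMV2000.qhat q))⁻¹ ^ 3) := by
  constructor
  · rintro ⟨Δ, hΔ, t, H⟩
    refine ⟨min Δ (3 / 2), lt_min hΔ (by norm_num), t, fun P hP Δ' h1 h2 ↦ ?_⟩
    obtain ⟨C₁, hC₁⟩ := norm_QhPQ_one_sub_explicit_le P
    obtain ⟨C, q₀, hC⟩ := H P hP Δ' h1 (h2.trans (min_le_left _ _))
    refine ⟨C + C₁, max q₀ 64, fun q _ hq hq₀ hgen ↦ ?_⟩
    have hA := hC q hq (le_trans (le_max_left _ _) hq₀) hgen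
    have hB := hC₁ Δ' h1 (h2.trans (min_le_right _ _)) q hq (le_trans (le_max_right _ _) hq₀)
    calc _ = ‖(KMV2000.QhPQ q P 1 (KMV2000.qhat q ^ Δ') -
              ((2 * riemannZeta 2 ^ 2 *
                  ((KMV2000.qhat q / (Δ' ^ 2 * Real.log (KMV2000.qhat q) ^ 2) : ℝ) : ℂ)) * ((t Δ' P : ℝ) : ℂ))) -
            (KMV2000.QhPQ q P 1 (KMV2000.qhat q ^ Δ') -
              (diagPart q P 1 Δ' - ∑ r ∈ Icc 1 (q ^ 8), layer q P 1 Δ' r))‖ := by ring_nf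
      _ ≤ _ := norm_sub_le _ _
      _ ≤ C * KMV2000.qhat q * (Real.log (KMV2000.qhat q))⁻¹ ^ 3 +
            C₁ * KMV2000.qhat q * (Real.log (KMV2000.qhat q))⁻¹ ^ 3 := add_le_add hA hB
      _ = (C + C₁) * KMV2000.qhat q * (Real.log (KMV2000.qhat q))⁻¹ ^ 3 := by ring
  · rintro ⟨Δ, hΔ, t, H⟩
    refine ⟨min Δ (3 / 2), lt_min hΔ (by norm_num), t, fun P hP Δ' h1 h2 ↦ ?_⟩
    obtain ⟨C₁, hC₁⟩ := norm_QhPQ_one_sub_explicit_le P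
    obtain ⟨C, q₀, hC⟩ := H P hP Δ' h1 (h2.trans (min_le_left _ _))
    refine ⟨C + C₁, max q₀ 64, fun q _ hq hq₀ hgen ↦ ?_⟩
    have hA := hC q hq (le_trans (le_max_left _ _) hq₀) hgen
    have hB := hC₁ Δ' h1 (h2.trans (min_le_right _ _)) q hq (le_trans (le_max_right _ _) hq₀)
    calc _ = ‖((diagPart q P 1 Δ' - ∑ r ∈ Icc 1 (q ^ 8), layer q P 1 Δ' r) -
              ((2 * riemannZeta 2 ^ 2 *
                  ((KMV2000.qhat q / (Δ' ^ 2 * Real.log (KMV2000.qhat q) ^ 2) : ℝ) : ℂ)) * ((t Δ' P : ℝ) : ℂ))) +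
            (KMV2000.QhPQ q P 1 (KMV2000.qhat q ^ Δ') -
              (diagPart q P 1 Δ' - ∑ r ∈ Icc 1 (q ^ 8), layer q P 1 Δ' r))‖ := by ring_nf
      _ ≤ _ := norm_add_le _ _
      _ ≤ C * KMV2000.qhat q * (Real.log (KMV2000.qhat q))⁻¹ ^ 3 +
            C₁ * KMV2000.qhat q * (Real.log (KMV2000.qhat q))⁻¹ ^ 3 := add_le_add hA hB
      _ = (C + C₁) * KMV2000.qhat q * (Real.log (KMV2000.qhat q))⁻¹ ^ 3 := by ring

/-! ## §3. K_A implies the explicit asymptotic -/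

/-- **§3. A NECESSARY CONDITION FOR THE CRUX, IN CUSP-FORM-FREE TERMS:** `MomentsBeyondDiagonal` (the registered K_A, all `Q`) implies that the
explicit finite sum `diagPart q P 1 Δ' − Σ_{r ≤ q⁸} layer q P 1 Δ' r` — Kloosterman sums `S(a,b;qr)` (`r ≤ q⁸`), Bessel values, Möbius coefficients,
KMV's cut-off `W`, NOTHING automorphic — has the second-display asymptotic with the level-free functional `secondMomentForm Δ' P 1 + T₂ Δ' P 1` on a
window beyond the diagonal. Refuting this explicit statement refutes K_A. -/
theorem explicitAtOne_of_momentsBeyondDiagonal (h : MomentsBeyondDiagonal) :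
    ∃ Δ : ℝ, 1 < Δ ∧ ∃ t : ℝ → ℝ[X] → ℝ, ∀ P : ℝ[X], KMV2000.Admissible P → ∀ Δ' : ℝ, 1 < Δ' → Δ' ≤ Δ →
      ∃ C : ℝ, ∃ q₀ : ℕ, ∀ (q : ℕ) [NeZero q], q.Prime → q₀ ≤ q →
        (∀ n : ℕ, (n : ℝ) ≠ KMV2000.qhat q ^ Δ') →
          ‖(diagPart q P 1 Δ' - ∑ r ∈ Icc 1 (q ^ 8), layer q P 1 Δ' r) -
              ((2 * riemannZeta 2 ^ 2 *
                  ((KMV2000.qhat q / (Δ' ^ 2 * Real.log (KMV2000.qhat q) ^ 2) : ℝ) : ℂ)) * ((t Δ' P : ℝ) : ℂ))‖ ≤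
            C * KMV2000.qhat q * (Real.log (KMV2000.qhat q))⁻¹ ^ 3 := by
  apply secondDisplayAtOne_iff_explicit.mp
  obtain ⟨Δ, hΔ, T₁, T₂, hMA⟩ := h
  refine ⟨Δ, hΔ, fun Δ' P ↦ KMV2000.secondMomentForm Δ' P 1 + T₂ Δ' P 1, fun P hP Δ' h1 h2 ↦ ?_⟩
  obtain ⟨C, q₀, H⟩ := hMA P 1 hP KMV2000.isEvenOrOdd_one Δ' h1 h2
  exact ⟨C, q₀, fun q _ hq hq₀ hgen ↦ (H q hq hq₀ hgen).2⟩

end Summit.Parity.GeneralizedHardyLittlewood.Theorems.PrimeLevelFamEdgeIdeaDeltas.PeterssonLayers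

end
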